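import Mathlib
import HarnessLib
import Summits.HubbardSuperconductivity.Statement

/-!
# Route BalabanIR — the Assembly, frame form (item stmt-HubbardSuperconductivity-13907)

The assembly item of route `HubbardSuperconductivity/BalabanIR` (rev ≥ 4) is the uncurried frame
statement `BirGroundStateAverageLRO ∧ BirEveryGroundState → HubbardSuperconductivity` — bookkeeping:
pure logic over the summit Statement, literally the route's deciding theorem `closes` uncurried.

Design constraint (why this file does NOT import the route module
`Summits.HubbardSuperconductivity.HubbardSuperconductivity.Theses.BalabanIR`): when an item closes,
the gate re-renders the route file with `import <closing module>` and
`theorem Assembly_holds : Assembly := …`; a closing module that itself imports the route module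
makes that render cycle (the rev-3 episode of this route: `Theorems/BalabanIRAssembly.lean`,
stmt-HubbardSuperconductivity-2085, see the route file's `Assembly` docstring). So the theorem
below is stated with the two crux statements INLINED VERBATIM (the bodies of
`BirGroundStateAverageLRO` and `BirEveryGroundState`, copied from the route file rev 4), so that its
type is definitionally (by `δ`-unfolding only) the route decl `Assembly`, and the route file can
import this module without a cycle — the same device as
`Summits/FinalStateConjecture/FinalStateConjecture/Theorems/PhotonSphereChannelsAssemblyFrame.lean`.

The proof is the body of `closes`: destructure the target's witnesses `δ, U₁, U₂, c`, apply the
average-to-every crux on the window `(U₁, U₂)` to get a coupling `U ∈ (U₁, U₂)` at which every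
normalised sector ground-state sequence has even-sides `d`-wave pair-field LRO, and repackage
(`0 < U₁ < U`) into `Literature.Hubbard.DWaveSuperconductivityHubbard`, the definiens of the summit
statement. No analysis, no new definitions.
-/

namespace Summit.HubbardSuperconductivity.HubbardSuperconductivity.Theorems

open scoped BigOperators Topology Manifold Classical MeasureTheory ProbabilityTheory Matrix InnerProductSpace ComplexConjugate ContinuousMap
open Filter Set Function TopologicalSpace MeasureTheory
open Literature.Hubbard

/-- **Assembly of route BalabanIR, frame form** (item stmt-HubbardSuperconductivity-13907):
`(X ∧ T) → HubbardSuperconductivity` with X = `BirGroundStateAverageLRO` (ground-state-AVERAGE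
`d_{x²-y²}` pair-field LRO on an open window of couplings at one doping `δ ∈ (0, 1/2)`) and T =
`BirEveryGroundState` (average ⇒ every normalised sector ground-state sequence, for SOME coupling of
the window), both written out verbatim so that this type unfolds to the route decl
`Summit.HubbardSuperconductivity.HubbardSuperconductivity.Theses.BalabanIR.Assembly` by `δ`-reduction
alone. Proof = the route's deciding theorem `closes`, uncurried. -/
theorem BalabanIR.assembly_frame_proof :
    (∃ δ ∈ Set.Ioo (0:ℝ) (1/2), ∃ U₁ U₂ c : ℝ, 0 < U₁ ∧ U₁ < U₂ ∧ 0 < c ∧ ∀ U ∈ Set.Ioo U₁ U₂, ∃ L₀ : ℕ, ∀ (L : ℕ) [NeZero L], L₀ ≤ L → Even L → let N : ℕ := 2 * ⌊(1 - δ) * (L : ℝ) ^ 2 / 2⌋₊; let H := Literature.MathematicalPhysics.QuantumLattice.hubbardTorus 2 L 1 U; let S := Literature.MathematicalPhysics.QuantumLattice.szSector (Λ := Literature.MathematicalPhysics.QuantumLattice.FermionTorus 2 L) N 0; let E₀ := S ⊓ Module.End.eigenspace (Matrix.toLin' H) ((H.minEnergyOn S : ℝ) : ℂ); let P := Literature.MathematicalPhysics.QuantumLattice.projMatrix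 (E₀.map (Literature.MathematicalPhysics.QuantumLattice.Fock.toEuclidean (ι := Literature.MathematicalPhysics.QuantumLattice.Orb (Literature.MathematicalPhysics.QuantumLattice.FermionTorus 2 L)) : Literature.MathematicalPhysics.QuantumLattice.Fock (Literature.MathematicalPhysics.QuantumLattice.Orb (Literature.MathematicalPhysics.QuantumLattice.FermionTorus 2 L)) →ₗ[ℂ] EuclideanSpace ℂ (Finset (Literature.MathematicalPhysics.QuantumLattice.Orb (Literature.MathematicalPhysics.QuantumLattice.FermionTorus 2 L))))); c * (L : ℝ) ^ 4 * P.trace.re ≤ (P * (Matrix.conjTranspose (Literature.MathematicalPhysics.QuantumLattice.pairField Literature.MathematicalPhysics.QuantumLattice.dWaveFormFactor L) * Literature.MathematicalPhysics.QuantumLattice.pairField Literature.MathematicalPhysics.QuantumLattice.dWaveFormFactor L)).trace.re) ∧ (∀ (δ U₁ U₂ c : ℝ), δ ∈ Set.Ioo (0:ℝ) (1/2) → 0 < U₁ → U₁ < U₂ → 0 < c → (∀ U ∈ Set.Ioo U₁ U₂, ∃ L₀ : ℕ, ∀ (L : ℕ) [NeZero L], L₀ ≤ L → Even L → let N : ℕ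 := 2 * ⌊(1 - δ) * (L : ℝ) ^ 2 / 2⌋₊; let H := Literature.MathematicalPhysics.QuantumLattice.hubbardTorus 2 L 1 U; let S := Literature.MathematicalPhysics.QuantumLattice.szSector (Λ := Literature.MathematicalPhysics.QuantumLattice.FermionTorus 2 L) N 0; let E₀ := S ⊓ Module.End.eigenspace (Matrix.toLin' H) ((H.minEnergyOn S : ℝ) : ℂ); let P := Literature.MathematicalPhysics.QuantumLattice.projMatrix (E₀.map (Literature.MathematicalPhysics.QuantumLattice.Fock.toEuclidean (ι := Literature.MathematicalPhysics.QuantumLattice.Orb (Literature.MathematicalPhysics.QuantumLattice.FermionTorus 2 L)) : Literature.MathematicalPhysics.QuantumLattice.Fock (Literature.MathematicalPhysics.QuantumLattice.Orb (Literature.MathematicalPhysics.QuantumLattice.FermionTorus 2 L)) →ₗ[ℂ] EuclideanSpace ℂ (Finset (Literature.MathematicalPhysics.QuantumLattice.Orb (Literature.MathematicalPhysics.QuantumLattice.FermionTorus 2 L))))); c * (L : ℝ) ^ 4 * P.trace.re ≤ (P * (Matrix.conjTranspose (Literature.MathematicalPhysics.QuantumLattice.pairField Literature.MathematicalPhysics.QuantumLattice.dWaveFormFactor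 L) * Literature.MathematicalPhysics.QuantumLattice.pairField Literature.MathematicalPhysics.QuantumLattice.dWaveFormFactor L)).trace.re) → ∃ U ∈ Set.Ioo U₁ U₂, ∀ (N : ℕ → ℕ) (ψ : ∀ L, Literature.MathematicalPhysics.QuantumLattice.Fock (Literature.MathematicalPhysics.QuantumLattice.Orb (Literature.MathematicalPhysics.QuantumLattice.FermionTorus 2 L))), (∀ L, Even L → N L = 2 * ⌊(1 - δ) * (L : ℝ) ^ 2 / 2⌋₊ ∧ star (ψ L) ⬝ᵥ ψ L = 1 ∧ Literature.MathematicalPhysics.QuantumLattice.IsGroundStateInSector (Literature.MathematicalPhysics.QuantumLattice.hubbardTorus 2 L 1 U) (N L) 0 (ψ L)) → Literature.Probability.LatticeModels.HasLongRangeOrder (fun k => Literature.Probability.LatticeModels.halfOpenBox 2 (2 * k)) (fun k => Literature.MathematicalPhysics.QuantumLattice.torusPullback (Literature.MathematicalPhysics.QuantumLattice.pairFieldCorr Literature.MathematicalPhysics.QuantumLattice.dWaveFormFactor ψ) (2 * k))) → _root_.HubbardSuperconductivity := by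
  rintro ⟨hX, hT⟩
  obtain ⟨δ, hδ, U₁, U₂, c, hU₁, hU₁₂, hc, h⟩ := hX
  obtain ⟨U, hU, hLRO⟩ := hT δ U₁ U₂ c hδ hU₁ hU₁₂ hc h
  show Literature.Hubbard.DWaveSuperconductivityHubbard
  exact ⟨U, lt_trans hU₁ hU.1, δ, hδ, hLRO⟩

end Summit.HubbardSuperconductivity.HubbardSuperconductivity.Theorems
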